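import Literature.Topology.FourManifolds.BandSum
import HarnessLib

/-!
# Pre-band data: a band attached to two knots, before the band sum is formed

Topic `Literature/Topology/FourManifolds` (trunk T-4MAN). Fact seat
`provefact-Literature.Topology.FourManifolds.Knot.exists_isBandSum` (`BandSum.lean`: existence of
band sums, R. E. Gompf, A. I. Stipsicz, *4-Manifolds and Kirby Calculus* (1999), §5.1).

The structure `Literature.Topology.FourManifolds.BandData K₁ K₂ K avoid` of `BandSum.lean` records
*both* the band (a smooth embedding of the open collar square meeting `K₁` exactly in its left edge
line, traversed upwards, and `K₂` exactly in its right edge line, traversed downwards) *and* the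
result `K` of the band sum (its range outside and inside the band, the two planar arcs, the
orientation clause of the result). The existence proof of band sums naturally splits in two:

1. from two disjoint knots and a path between them off `avoid`, construct **a band** — the
   fields of `BandData` which do not mention `K`;
2. from a band, construct **the knot** `K` and the remaining fields (the rebuilding construction
   of `BandRebuildArches.lean`, `BandRebuildCurve.lean`, `SchubertNormalForm.lean`, which — although
   phrased there for `b : BandData A B K avoid` — only ever uses the fields of step 1).

This file introduces the intermediate notion for step 1:

* `Literature.Topology.FourManifolds.PreBandData K₁ K₂ avoid` — the `K`-free part of `BandData`
  (same field names and statements);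
* `Literature.Topology.FourManifolds.BandData.toPre` — forgetting the result of a band sum;
* the elementary API `PreBandData.support`, `PreBandData.disjoint_inter_support`,
  `PreBandData.mono` (verbatim from `BandData`).

Everything here is a definition or proved; no named facts are introduced.

## References

* R. E. Gompf, A. I. Stipsicz, *4-Manifolds and Kirby Calculus*, GSM 20, AMS (1999), §5.1
  (band sums; Fig. 5.7). [GompfStipsicz1999]
* P. R. Cromwell, *Knots and Links*, Cambridge University Press (2004), §4.6 (the product of
  oriented knots along a rectangle `R` with `L₁ ∩ R = a`, `L₂ ∩ R = c`). [Cromwell2004]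
-/

open scoped Manifold ContDiff Topology
open Function Set

noncomputable section

namespace Literature.Topology.FourManifolds

/-- Local notation: `𝔼 n` is the model Euclidean space `EuclideanSpace ℝ (Fin n)`. -/
local notation "𝔼 " n:arg => EuclideanSpace ℝ (Fin n)

/-- Local notation: `𝕊 n` is the unit sphere in `EuclideanSpace ℝ (Fin (n + 1))`. -/
local notation "𝕊 " n:arg => (Metric.sphere (0 : EuclideanSpace ℝ (Fin (n + 1))) 1)

/-- **Pre-band data**: a band attached to the (disjoint) knots `K₁`, `K₂` and avoiding the set
`avoid` — the fields of `Literature.Topology.FourManifolds.BandData` which do not involve the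
result of the band sum. `band : ℝ² → 𝕊 3` is smooth and restricts to an embedding of the open
collar square `squareNhd δ = (-δ, 1 + δ)²` whose image misses `avoid`; inside the image, `K₁` is
exactly the left edge line `band '' {x₀ = 0}`, traversed upwards (`orient_left`), and `K₂` is
exactly the right edge line `band '' {x₀ = 1}`, traversed downwards (`orient_right`); see the
docstring of `BandData` for the picture. Gompf–Stipsicz (1999), §5.1, Fig. 5.7; Cromwell (2004),
§4.6. [cite: GompfStipsicz1999, §5.1] -/
structure PreBandData (K₁ K₂ : Knot) (avoid : Set (𝕊 3)) where
  /-- The band, a smooth map `ℝ² → 𝕊 3` (only its restriction to `squareNhd δ` matters). -/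
  band : 𝔼 2 → 𝕊 3
  /-- The width of the collar of the unit square on which `band` is an embedding. -/
  δ : ℝ
  /-- The collar width is positive. -/
  δ_pos : 0 < δ
  /-- The band map is `C^∞`. -/
  contMDiff : ContMDiff 𝓘(ℝ, 𝔼 2) (𝓡 3) ∞ band
  /-- The band map is injective on the square neighbourhood. -/
  injOn : InjOn band (squareNhd δ)
  /-- The band map is an immersion on the square neighbourhood. -/
  injective_mfderiv : ∀ x ∈ squareNhd δ, Injective (mfderiv 𝓘(ℝ, 𝔼 2) (𝓡 3) band x)
  /-- The band misses `avoid`. -/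
  disjoint_avoid : Disjoint (band '' squareNhd δ) avoid
  /-- `K₁` meets the band exactly in the left edge line `x₀ = 0`. -/
  preimage_left : band ⁻¹' range K₁ ∩ squareNhd δ = {x ∈ squareNhd δ | x 0 = 0}
  /-- `K₂` meets the band exactly in the right edge line `x₀ = 1`. -/
  preimage_right : band ⁻¹' range K₂ ∩ squareNhd δ = {x ∈ squareNhd δ | x 0 = 1}
  /-- Orientation of `K₁` along the left edge: upwards (velocity of `K₁` at the mid-point
  `band (0, 1/2)` is a positive multiple of `∂band/∂x₁`, compared in `ℝ⁴ ⊇ 𝕊 3`). -/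
  orient_left : ∃ θ c : ℝ, 0 < c ∧ K₁ (circlePoint θ) = band (pt2 0 2⁻¹) ∧
    deriv (fun t ↦ ((K₁ (circlePoint t) : 𝕊 3) : 𝔼 4)) θ =
      c • fderiv ℝ (fun x ↦ ((band x : 𝕊 3) : 𝔼 4)) (pt2 0 2⁻¹) (pt2 0 1)
  /-- Orientation of `K₂` along the right edge: downwards. -/
  orient_right : ∃ θ c : ℝ, 0 < c ∧ K₂ (circlePoint θ) = band (pt2 1 2⁻¹) ∧
    deriv (fun t ↦ ((K₂ (circlePoint t) : 𝕊 3) : 𝔼 4)) θ =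
      c • fderiv ℝ (fun x ↦ ((band x : 𝕊 3) : 𝔼 4)) (pt2 1 2⁻¹) (pt2 0 (-1))

namespace PreBandData

variable {K₁ K₂ : Knot} {avoid : Set (𝕊 3)}

/-- The image `band '' squareNhd δ` of the band: the smoothly embedded open surface in `𝕊 3`
along which the band sum modifies `K₁ ∪ K₂`. [folklore] -/
def support (b : PreBandData K₁ K₂ avoid) : Set (𝕊 3) :=
  b.band '' squareNhd b.δ

/-- The two knots are disjoint inside the band (the edge lines `x₀ = 0` and `x₀ = 1` are
disjoint). [folklore] -/
theorem disjoint_inter_support (b : PreBandData K₁ K₂ avoid) :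
    Disjoint (range K₁ ∩ b.support) (range K₂ ∩ b.support) := by
  rw [Set.disjoint_left]
  rintro y ⟨hy₁, x, hx, rfl⟩ ⟨hy₂, -⟩
  have h₁ : x ∈ b.band ⁻¹' range K₁ ∩ squareNhd b.δ := ⟨hy₁, hx⟩
  have h₂ : x ∈ b.band ⁻¹' range K₂ ∩ squareNhd b.δ := ⟨hy₂, hx⟩
  rw [b.preimage_left] at h₁
  rw [b.preimage_right] at h₂
  have := h₁.2.symm.trans h₂.2
  norm_num at this

/-- Pre-band data avoiding `avoid` also avoids any smaller set. [folklore] -/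
def mono (b : PreBandData K₁ K₂ avoid) {avoid' : Set (𝕊 3)} (h : avoid' ⊆ avoid) :
    PreBandData K₁ K₂ avoid' :=
  { b with disjoint_avoid := b.disjoint_avoid.mono_right h }

/-- `mono` keeps the band. [folklore] -/
@[simp] theorem mono_band (b : PreBandData K₁ K₂ avoid) {avoid' : Set (𝕊 3)} (h : avoid' ⊆ avoid) :
    (b.mono h).band = b.band := rfl

/-- `mono` keeps the collar width. [folklore] -/
@[simp] theorem mono_δ (b : PreBandData K₁ K₂ avoid) {avoid' : Set (𝕊 3)} (h : avoid' ⊆ avoid) :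
    (b.mono h).δ = b.δ := rfl

end PreBandData

namespace BandData

variable {K₁ K₂ K : Knot} {avoid : Set (𝕊 3)}

/-- **Forgetting the result of a band sum**: the pre-band data (band, collar width, and the
clauses about `K₁`, `K₂`) underlying band-sum data. [folklore] -/
def toPre (b : BandData K₁ K₂ K avoid) : PreBandData K₁ K₂ avoid where
  band := b.band
  δ := b.δ
  δ_pos := b.δ_pos
  contMDiff := b.contMDiff
  injOn := b.injOn
  injective_mfderiv := b.injective_mfderiv
  disjoint_avoid := b.disjoint_avoid
  preimage_left := b.preimage_left
  preimage_right := b.preimage_right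
  orient_left := b.orient_left
  orient_right := b.orient_right

/-- `toPre` keeps the band. [folklore] -/
@[simp] theorem toPre_band (b : BandData K₁ K₂ K avoid) : b.toPre.band = b.band := rfl

/-- `toPre` keeps the collar width. [folklore] -/
@[simp] theorem toPre_δ (b : BandData K₁ K₂ K avoid) : b.toPre.δ = b.δ := rfl

/-- `toPre` keeps the support. [folklore] -/
@[simp] theorem toPre_support (b : BandData K₁ K₂ K avoid) : b.toPre.support = b.support := rfl

end BandData

end Literature.Topology.FourManifolds
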